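import Literature.NumberTheory.LFunctions.NymanBeurlingVectorsHigher
import Literature.NumberTheory.LFunctions.NymanBeurlingVectorsOrthogonal
import Literature.NumberTheory.LFunctions.ZetaZerosProofs
import Literature.NumberTheory.LFunctions.ZetaLogDerivDisc
import HarnessLib

/-!
# Burnol's higher vectors are orthogonal to `𝓑_λ` (multiplicity `> k`)

Continuation of `Literature/NumberTheory/LFunctions/NymanBeurlingVectorsHigher.lean` and
`NymanBeurlingVectorsOrthogonal.lean`. For a zero `ρ = 1/2 + iγ` of `ζ` of multiplicity
`m(ρ) = riemannZetaZeroOrder ρ > k`, `0 < λ < 1`, `1 ≤ a ≤ 1/λ` and `s = 1/2 + iτ` we prove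

  `∫ (a^{-s}(-ζ(s)/s)) · burnolKk ρ k λ s dτ = 0`   (`integral_mellin_fract_mul_burnolKk_eq_zero`),

i.e. (by the Parseval pairing of `NymanBeurlingVectors.lean`, `a^{-s}(-ζ(s)/s)` being the Mellin
transform of `t ↦ {1/(at)}`) the vector `𝓜⁻¹(conj ∘ K_k)` is orthogonal in `L²(0,∞)` to every
generator of `𝓑_λ` — Burnol's Theorem 4.2/Corollary 4.3 ("`Y^λ_{s,k}` is perpendicular to `𝓒_λ` if
and only if `ζ^{(j)}(s) = 0` for all `j ≤ k`, if and only if `s` is a zero `ρ` of the zeta function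
and `k < m_ρ`") for the data of the previous file. By the pole expansion of `K_k` it suffices to
treat the pieces `r(s)/(s-ρ)^n` and `(V(s)/V(ρ))λ^{ρ-s} r(s)/(s-ρ)^n`, `1 ≤ n ≤ k+1`: exactly as
for `k = 0` (`n = 1`, the tree's `partR`/`partL`),

  `(a^{-s}(-ζ(s)/s)) · r(s)/(s-ρ)^n = -h_{R,n}(s)`,  `h_{R,n}(s) = θ^s ζ₁(s)/(s⁵(s-ρ)^n)`, `θ = 1/a`,
  `(a^{-s}(-ζ(s)/s)) · (V(s)/V(ρ))λ^{ρ-s} r(s)/(s-ρ)^n = (λ^ρ/V(ρ)) h_{L,n}(s)`,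
  `h_{L,n}(s) = y^s ζ₁(1-s)/((s-1)⁵(s-ρ)^n)`, `y = 1/(aλ) ≥ 1`,

where `ζ₁(s)/(s-ρ)^n` and `ζ₁(1-s)/(s-ρ)^n` are entire because `ζ₁` vanishes to order
`m(ρ) ≥ n` at `ρ` and at `1 - ρ = conj ρ` (`riemannZetaZeroOrder_conj_holds`; the entire functions
are the iterated divided differences `dsl ζ₁ ρ n`, identified with the quotients by
`dsl_riemannZeta₁_eq_div` from `natCast_le_analyticOrderAt`). `h_{R,n}`, `h_{L,n}` are `O(|s|⁻²)` on
vertical strips (Euler–Maclaurin bound for `ζ₁`), the lines may be moved to `re s = 2`, resp.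
`re s = -1`, where the Dirichlet series converge absolutely and every term integrates to `0` by
closing the contour (`Literature.Analysis.Complex.integral_vertical_mul_cpow_eq_zero_of_le_one` /
`_of_one_le`). No poles are crossed.

## References

* J.-F. Burnol, *A lower bound in an approximation problem involving the zeros of the Riemann
  zeta function*, Adv. Math. 170 (2002), 56–70; arXiv:math/0103058, Thm. 4.2, Cor. 4.3.
-/

noncomputable section

open Complex Filter MeasureTheory Set Asymptotics
open scoped Real Topology ComplexConjugate Nat

namespace Literature.NumberTheory.LFunctions

namespace BurnolVectors

/-! ## Vanishing to order `n` and the entire functions `ζ₁(s)/(s-ρ)^n` -/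

/-- `ζ₁` is analytic everywhere. [folklore] -/
theorem analyticOnNhd_riemannZeta₁ : AnalyticOnNhd ℂ riemannZeta₁ Set.univ :=
  differentiable_riemannZeta₁.differentiableOn.analyticOnNhd isOpen_univ

/-- **From the multiplicity to a local factorisation of `ζ₁`.** If `ρ ≠ 1` and
`n ≤ m(ρ) = riemannZetaZeroOrder ρ`, then `ζ₁ = (z-ρ)^n g` near `ρ` with `g` analytic at `ρ`.
[folklore] -/
theorem riemannZeta₁_eq_pow_mul_of_le_order {ρ : ℂ} (hρ1 : ρ ≠ 1) {n : ℕ}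
    (hn : (n : ℤ) ≤ riemannZetaZeroOrder ρ) :
    ∃ g : ℂ → ℂ, AnalyticAt ℂ g ρ ∧ ∀ᶠ z in 𝓝 ρ, riemannZeta₁ z = (z - ρ) ^ n * g z := by
  have ha : AnalyticAt ℂ riemannZeta ρ := analyticOn_riemannZeta ρ hρ1
  have hle : (n : ℕ∞) ≤ analyticOrderAt riemannZeta ρ := by
    cases h : analyticOrderAt riemannZeta ρ with
    | top => exact le_top
    | coe N =>
      have hN : riemannZetaZeroOrder ρ = N := by
        rw [riemannZetaZeroOrder, ha.meromorphicOrderAt_eq, h, ENat.map_coe, WithTop.untop₀_coe]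
      rw [hN] at hn
      exact_mod_cast hn
  obtain ⟨g, hg, hfg⟩ := (natCast_le_analyticOrderAt ha).1 hle
  refine ⟨fun z ↦ (z - 1) * g z, (analyticAt_id.sub analyticAt_const).mul hg, ?_⟩
  filter_upwards [hfg, isOpen_ne.mem_nhds hρ1] with z hz hz1
  rw [riemannZeta₁_eq_mul hz1, hz, smul_eq_mul]
  ring

/-- **`dsl ζ₁ ρ n = ζ₁(s)/(s-ρ)^n` off `ρ`** when `n ≤ m(ρ)` (`ρ ≠ 1`). [folklore] -/
theorem dsl_riemannZeta₁_eq_div {ρ : ℂ} (hρ1 : ρ ≠ 1) {n : ℕ}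
    (hn : (n : ℤ) ≤ riemannZetaZeroOrder ρ) {s : ℂ} (hs : s ≠ ρ) :
    dsl riemannZeta₁ ρ n s = riemannZeta₁ s / (s - ρ) ^ n := by
  obtain ⟨g, hg, hfg⟩ := riemannZeta₁_eq_pow_mul_of_le_order hρ1 hn
  exact dsl_eq_div analyticOnNhd_riemannZeta₁ (Set.mem_univ ρ) hg.continuousAt hfg hs

/-- On the critical line `1 - ρ = conj ρ`, so `m(1-ρ) = m(ρ)` (tree:
`riemannZetaZeroOrder_conj_holds`). [folklore] -/
theorem riemannZetaZeroOrder_one_sub_line (γ : ℝ) :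
    riemannZetaZeroOrder (1 - ((1 / 2 : ℂ) + γ * I)) = riemannZetaZeroOrder ((1 / 2 : ℂ) + γ * I) := by
  rw [one_sub_eq_conj]
  exact riemannZetaZeroOrder_conj_holds _

/-! ## The right parts `h_{R,n}(s) = θ^s ζ₁(s) / (s⁵ (s - ρ)^n)` -/

section partR

variable {ρ : ℂ} {n : ℕ}
  (hdsl : ∀ s : ℂ, s ≠ ρ → dsl riemannZeta₁ ρ n s = riemannZeta₁ s / (s - ρ) ^ n)
include hdsl

/-- `h_{R,n}` off the base point. [folklore] -/
theorem partRn_eq {θ : ℝ} {s : ℂ} (hs : s ≠ ρ) :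
    partRn θ ρ n s = (θ : ℂ) ^ s * riemannZeta₁ s / (s ^ 5 * (s - ρ) ^ n) := by
  rw [partRn, hdsl s hs, ← mul_div_assoc, div_div, mul_comm ((s - ρ) ^ n)]

/-- `h_{R,n}` in terms of `ζ`: `θ^s (s-1)ζ(s)/(s⁵(s-ρ)^n)` for `s ≠ ρ, 1`. [folklore] -/
theorem partRn_eq_zeta {θ : ℝ} {s : ℂ} (hs : s ≠ ρ) (hs1 : s ≠ 1) :
    partRn θ ρ n s = (θ : ℂ) ^ s * ((s - 1) * riemannZeta s) / (s ^ 5 * (s - ρ) ^ n) := by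
  rw [partRn_eq hdsl hs, riemannZeta₁_eq_mul hs1]

omit hdsl in
/-- `h_{R,n}` is complex differentiable away from `s = 0` (for `θ > 0`). [folklore] -/
theorem differentiableAt_partRn {θ : ℝ} (hθ : 0 < θ) (ρ : ℂ) (n : ℕ) {s : ℂ} (hs : s ≠ 0) :
    DifferentiableAt ℂ (partRn θ ρ n) s := by
  unfold partRn
  refine DifferentiableAt.div (DifferentiableAt.mul ?_ ?_) (by fun_prop) (pow_ne_zero _ hs)
  · exact differentiableAt_id.const_cpow (Or.inl (by exact_mod_cast hθ.ne'))
  · exact (analyticOnNhd_dsl analyticOnNhd_riemannZeta₁ ρ n s (Set.mem_univ s)).differentiableAt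

/-- **Decay of `h_{R,n}`** (`n ≥ 1`): for `0 < θ ≤ 1`, `0 ≤ re s`, `‖s‖ ≥ max 2 (2‖ρ‖)`:
`‖h_{R,n}(s)‖ ≤ 32/‖s‖²`. [folklore] -/
theorem norm_partRn_le (hn : 1 ≤ n) {θ : ℝ} (hθ : 0 < θ) (hθ1 : θ ≤ 1)
    (hρ : ρ ≠ 0) {s : ℂ} (hs0 : 0 ≤ s.re) (hs : max 2 (2 * ‖ρ‖) ≤ ‖s‖) :
    ‖partRn θ ρ n s‖ ≤ 32 / ‖s‖ ^ 2 := by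
  have h2 : 2 ≤ ‖s‖ := le_of_max_le_left hs
  have h2ρ : 2 * ‖ρ‖ ≤ ‖s‖ := le_of_max_le_right hs
  have hρpos : 0 < ‖ρ‖ := norm_pos_iff.2 hρ
  have hsρ : s ≠ ρ := by
    intro h; rw [h] at h2ρ; linarith
  have hspos : 0 < ‖s‖ := by linarith
  rw [partRn_eq hdsl hsρ, norm_div, norm_mul, norm_mul, norm_pow, norm_pow,
    norm_cpow_eq_rpow_re_of_pos hθ]
  have hθs : θ ^ s.re ≤ 1 := Real.rpow_le_one hθ.le hθ1 hs0
  have hζ1 : ‖riemannZeta₁ s‖ ≤ (‖s‖ + 2) ^ 4 :=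
    norm_riemannZeta₁_le (by linarith [abs_re_le_norm s, abs_le.1 (abs_re_le_norm s)])
  have hζ2 : (‖s‖ + 2) ^ 4 ≤ 16 * ‖s‖ ^ 4 := by
    have : ‖s‖ + 2 ≤ 2 * ‖s‖ := by linarith
    calc (‖s‖ + 2) ^ 4 ≤ (2 * ‖s‖) ^ 4 := pow_le_pow_left₀ (by positivity) this 4
      _ = 16 * ‖s‖ ^ 4 := by ring
  have hsub : ‖s‖ / 2 ≤ ‖s - ρ‖ := by
    have h' : ‖s‖ - ‖ρ‖ ≤ ‖s - ρ‖ := by linarith [abs_norm_sub_norm_le s ρ, le_abs_self (‖s‖ - ‖ρ‖)]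
    linarith
  have hsub1 : 1 ≤ ‖s - ρ‖ := by linarith
  have hsubn : ‖s - ρ‖ ≤ ‖s - ρ‖ ^ n := le_self_pow₀ hsub1 (by omega)
  have hsρpos : 0 < ‖s - ρ‖ ^ n := pow_pos (by linarith) n
  rw [div_le_div_iff₀ (mul_pos (pow_pos hspos 5) hsρpos) (pow_pos hspos 2)]
  calc θ ^ s.re * ‖riemannZeta₁ s‖ * ‖s‖ ^ 2 ≤ 1 * (16 * ‖s‖ ^ 4) * ‖s‖ ^ 2 := by
        gcongr; exact hζ1.trans hζ2
    _ = 32 * (‖s‖ ^ 5 * (‖s‖ / 2)) := by ring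
    _ ≤ 32 * (‖s‖ ^ 5 * ‖s - ρ‖ ^ n) := by gcongr; exact hsub.trans hsubn

/-- `h_{R,n}` is integrable along every line `re s = σ > 0` (for `0 < θ ≤ 1`, `n ≥ 1`). [folklore] -/
theorem integrable_partRn_line (hn : 1 ≤ n) {θ : ℝ} (hθ : 0 < θ) (hθ1 : θ ≤ 1)
    (hρ : ρ ≠ 0) {σ : ℝ} (hσ : 0 < σ) :
    Integrable fun y : ℝ ↦ partRn θ ρ n ((σ : ℂ) + y * I) := by
  have hcont : Continuous fun y : ℝ ↦ partRn θ ρ n ((σ : ℂ) + y * I) :=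
    continuous_line_of_differentiableAt σ fun y ↦ differentiableAt_partRn hθ ρ n fun h ↦ by
      have := congrArg Complex.re h; simp at this; linarith
  refine integrable_of_continuous_of_norm_le hcont (T := max 2 (2 * ‖ρ‖)) (C := 2 * 32) fun y hy ↦ ?_
  exact norm_le_inv_one_add_sq_of_le (by norm_num) (le_trans (by norm_num) (le_max_left _ _))
    (fun hs ↦ norm_partRn_le hdsl hn hθ hθ1 hρ (by simp; exact hσ.le) hs) hy

/-- **Shifting `h_{R,n}` from the critical line to `re s = 2`**. [folklore] -/
theorem integral_partRn_half_eq_two (hn : 1 ≤ n) {θ : ℝ} (hθ : 0 < θ) (hθ1 : θ ≤ 1)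
    (hρ : ρ.re = 1 / 2) :
    ∫ y : ℝ, partRn θ ρ n (((1 / 2 : ℝ) : ℂ) + y * I) = ∫ y : ℝ, partRn θ ρ n (((2 : ℝ) : ℂ) + y * I) := by
  have hρ0 := ne_zero_of_re_eq_half hρ
  refine Literature.Analysis.Complex.integral_vertical_eq_of_differentiableOn (by norm_num) ?_
    (integrable_partRn_line hdsl hn hθ hθ1 hρ0 (by norm_num))
    (integrable_partRn_line hdsl hn hθ hθ1 hρ0 (by norm_num)) ?_
  · intro s hs
    refine (differentiableAt_partRn hθ ρ n fun h ↦ ?_).differentiableWithinAt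
    have h1 : (1 / 2 : ℝ) ≤ s.re := hs.1
    rw [h, zero_re] at h1
    norm_num at h1
  · exact horizontal_decay_of_le (le_trans (by norm_num) (le_max_left 2 (2 * ‖ρ‖)))
      fun s ha _ hs ↦ norm_partRn_le hdsl hn hθ hθ1 hρ0 (by linarith) hs

omit hdsl in
/-- `q_{R,n}` is complex differentiable away from `0` and `ρ`. [folklore] -/
theorem differentiableAt_qRn {s : ℂ} (hs0 : s ≠ 0) (hsρ : s ≠ ρ) :
    DifferentiableAt ℂ (qRn ρ n) s := by
  unfold qRn
  exact DifferentiableAt.div (by fun_prop) (by fun_prop)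
    (mul_ne_zero (pow_ne_zero _ hs0) (pow_ne_zero _ (sub_ne_zero.2 hsρ)))

omit hdsl in
/-- `q_{R,n}` is complex differentiable on `re s ≥ 2` (`re ρ = 1/2`). [folklore] -/
theorem differentiableOn_qRn (hρ : ρ.re = 1 / 2) :
    DifferentiableOn ℂ (qRn ρ n) {s : ℂ | 2 ≤ s.re} := by
  intro s hs
  simp only [mem_setOf_eq] at hs
  have hs0 : s ≠ 0 := fun h ↦ by rw [h] at hs; simp at hs; linarith
  have hsρ : s ≠ ρ := fun h ↦ by rw [h, hρ] at hs; norm_num at hs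
  exact (differentiableAt_qRn hs0 hsρ).differentiableWithinAt

omit hdsl in
/-- `‖q_{R,n}(s)‖ ≤ 1/‖s‖²` on `re s ≥ 2` (`n ≥ 1`). [folklore] -/
theorem norm_qRn_le (hn : 1 ≤ n) (hρ : ρ.re = 1 / 2) {s : ℂ} (hs : 2 ≤ s.re) :
    ‖qRn ρ n s‖ ≤ 1 / ‖s‖ ^ 2 := by
  have hns : 2 ≤ ‖s‖ := hs.trans (re_le_norm s)
  have hsρ : 3 / 2 ≤ ‖s - ρ‖ := by
    have := re_le_norm (s - ρ)
    rw [sub_re, hρ] at this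
    linarith
  have hsρn : ‖s - ρ‖ ≤ ‖s - ρ‖ ^ n := le_self_pow₀ (by linarith) (by omega)
  have h1 : ‖s - 1‖ ≤ ‖s‖ + 1 := (norm_sub_le _ _).trans (by simp)
  have hspos : 0 < ‖s‖ := by linarith
  rw [qRn, norm_div, norm_mul, norm_pow, norm_pow,
    div_le_div_iff₀ (mul_pos (pow_pos hspos 5) (by positivity)) (pow_pos hspos 2), one_mul]
  calc ‖s - 1‖ * ‖s‖ ^ 2 ≤ (‖s‖ + 1) * ‖s‖ ^ 2 := by gcongr
    _ ≤ (2 * ‖s‖) * ‖s‖ ^ 2 := by gcongr; linarith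
    _ = ‖s‖ ^ 3 * 2 := by ring
    _ ≤ ‖s‖ ^ 3 * (‖s‖ ^ 2 * (3 / 2)) := by gcongr; nlinarith
    _ = ‖s‖ ^ 5 * (3 / 2) := by ring
    _ ≤ ‖s‖ ^ 5 * ‖s - ρ‖ ^ n := by gcongr; exact hsρ.trans hsρn

/-- **`h_{R,n}` on `re s = 2` as an absolutely convergent series**:
`h_{R,n}(s) = ∑_m q_{R,n}(s) (θ/(m+1))^s`. [folklore] -/
theorem partRn_two_eq_tsum {θ : ℝ} (hθ : 0 < θ) (hρ : ρ.re = 1 / 2) (y : ℝ) :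
    partRn θ ρ n (((2 : ℝ) : ℂ) + y * I) =
      ∑' m : ℕ, qRn ρ n (((2 : ℝ) : ℂ) + y * I) * ((θ / (m + 1) : ℝ) : ℂ) ^ (((2 : ℝ) : ℂ) + y * I) := by
  set s : ℂ := ((2 : ℝ) : ℂ) + y * I with hsdef
  have hsre : s.re = 2 := by simp [hsdef]
  have hsρ : s ≠ ρ := fun h ↦ by rw [h] at hsre; rw [hρ] at hsre; norm_num at hsre
  have hs1 : s ≠ 1 := fun h ↦ by rw [h] at hsre; simp at hsre
  rw [partRn_eq_zeta hdsl hsρ hs1, zeta_eq_tsum_one_div_nat_add_one_cpow (by rw [hsre]; norm_num)]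
  have e : ∀ m : ℕ, qRn ρ n s * ((θ / (m + 1) : ℝ) : ℂ) ^ s =
      ((θ : ℂ) ^ s * (s - 1) / (s ^ 5 * (s - ρ) ^ n)) * (1 / ((m : ℂ) + 1) ^ s) := by
    intro m
    rw [cpow_div_natSucc hθ.le, qRn]
    ring
  simp_rw [e]
  rw [tsum_mul_left]
  ring

omit hdsl in
/-- The terms of the series for `h_{R,n}` on `re s = 2` are integrable, with summable bounds.
[folklore] -/
theorem integrable_qRn_mul_cpow (hn : 1 ≤ n) {θ : ℝ} (hθ : 0 < θ) (hρ : ρ.re = 1 / 2) (m : ℕ) :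
    Integrable (fun y : ℝ ↦ qRn ρ n (((2 : ℝ) : ℂ) + y * I) * ((θ / (m + 1) : ℝ) : ℂ) ^ (((2 : ℝ) : ℂ) + y * I)) ∧
      ∫ y : ℝ, ‖qRn ρ n (((2 : ℝ) : ℂ) + y * I) * ((θ / (m + 1) : ℝ) : ℂ) ^ (((2 : ℝ) : ℂ) + y * I)‖ ≤
        (θ / (m + 1)) ^ 2 * π := by
  have hx : 0 < θ / (m + 1) := by positivity
  have hbound : ∀ y : ℝ, ‖qRn ρ n (((2 : ℝ) : ℂ) + y * I) * ((θ / (m + 1) : ℝ) : ℂ) ^ (((2 : ℝ) : ℂ) + y * I)‖ ≤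
      (θ / (m + 1)) ^ 2 * (1 + y ^ 2)⁻¹ := by
    intro y
    rw [norm_mul, norm_cpow_eq_rpow_re_of_pos hx, mul_comm]
    have hre : (((2 : ℝ) : ℂ) + y * I).re = 2 := by simp
    rw [hre, Real.rpow_two]
    gcongr
    refine (norm_qRn_le hn hρ (by rw [hre])).trans ?_
    have hpos : 0 < ‖((2 : ℝ) : ℂ) + y * I‖ := by
      have := re_le_norm (((2 : ℝ) : ℂ) + y * I); rw [hre] at this; linarith
    rw [one_div, inv_le_inv₀ (pow_pos hpos 2) (by positivity), Complex.sq_norm, normSq_add_mul_I]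
    nlinarith
  have hcont : Continuous fun y : ℝ ↦ qRn ρ n (((2 : ℝ) : ℂ) + y * I) * ((θ / (m + 1) : ℝ) : ℂ) ^ (((2 : ℝ) : ℂ) + y * I) := by
    refine Continuous.mul ?_ ?_
    · refine continuous_line_of_differentiableAt 2 fun y ↦ differentiableAt_qRn ?_ ?_
      · intro h; have := congrArg Complex.re h; simp at this
      · intro h; have := congrArg Complex.re h; rw [hρ] at this; simp at this; norm_num at this
    · exact continuous_line_of_differentiableAt 2 fun y ↦
        differentiableAt_id.const_cpow (Or.inl (by exact_mod_cast hx.ne'))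
  have hint : Integrable fun y : ℝ ↦ qRn ρ n (((2 : ℝ) : ℂ) + y * I) * ((θ / (m + 1) : ℝ) : ℂ) ^ (((2 : ℝ) : ℂ) + y * I) :=
    integrable_of_continuous_of_norm_le hcont (T := 0) fun y _ ↦ hbound y
  refine ⟨hint, ?_⟩
  calc ∫ y : ℝ, ‖qRn ρ n (((2 : ℝ) : ℂ) + y * I) * ((θ / (m + 1) : ℝ) : ℂ) ^ (((2 : ℝ) : ℂ) + y * I)‖
      ≤ ∫ y : ℝ, (θ / (m + 1)) ^ 2 * (1 + y ^ 2)⁻¹ :=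
        integral_mono hint.norm (integrable_inv_one_add_sq.const_mul _) hbound
    _ = (θ / (m + 1)) ^ 2 * π := by rw [integral_const_mul, integral_univ_inv_one_add_sq]

/-- **`∫ h_{R,n} = 0` along the critical line** (`0 < θ ≤ 1`, `1 ≤ n ≤ m(ρ)`, `re ρ = 1/2`).
[cite: Burnol2002, Thm. 4.2 (proof)] -/
theorem integral_partRn_eq_zero (hn : 1 ≤ n) {θ : ℝ} (hθ : 0 < θ) (hθ1 : θ ≤ 1)
    (hρ : ρ.re = 1 / 2) :
    ∫ y : ℝ, partRn θ ρ n (((1 / 2 : ℝ) : ℂ) + y * I) = 0 := by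
  rw [integral_partRn_half_eq_two hdsl hn hθ hθ1 hρ]
  simp_rw [partRn_two_eq_tsum hdsl hθ hρ]
  have hsum : Summable fun m : ℕ ↦ ∫ y : ℝ,
      ‖qRn ρ n (((2 : ℝ) : ℂ) + y * I) * ((θ / (m + 1) : ℝ) : ℂ) ^ (((2 : ℝ) : ℂ) + y * I)‖ := by
    have h1 : Summable fun m : ℕ ↦ (θ / (m + 1)) ^ 2 * π := by
      have := (summable_nat_add_iff 1).2 (Real.summable_one_div_nat_pow.2 one_lt_two)
      simp only [Nat.cast_add, Nat.cast_one] at this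
      refine (this.mul_left (θ ^ 2 * π)).congr fun m ↦ ?_
      field_simp
    exact Summable.of_nonneg_of_le (fun m ↦ integral_nonneg fun y ↦ norm_nonneg _)
      (fun m ↦ (integrable_qRn_mul_cpow hn hθ hρ m).2) h1
  rw [← integral_tsum_of_summable_integral_norm (fun m ↦ (integrable_qRn_mul_cpow hn hθ hρ m).1) hsum]
  have h0 : ∀ m : ℕ, ∫ y : ℝ, qRn ρ n (((2 : ℝ) : ℂ) + y * I) *
      ((θ / (m + 1) : ℝ) : ℂ) ^ (((2 : ℝ) : ℂ) + y * I) = 0 := by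
    intro m
    have hx1 : θ / (m + 1) ≤ 1 := by
      rw [div_le_one (by positivity)]
      exact hθ1.trans (by simp)
    exact Literature.Analysis.Complex.integral_vertical_mul_cpow_eq_zero_of_le_one (C := 1) two_pos
      (differentiableOn_qRn hρ) (fun s hs ↦ norm_qRn_le hn hρ hs) (by positivity) hx1
  simp_rw [h0]
  exact tsum_zero

end partR

/-! ## The left parts `h_{L,n}(s) = y^s ζ₁(1-s) / ((s-1)⁵ (s - ρ)^n)` -/

section partL

variable {ρ : ℂ} {n : ℕ}
  (hdsl' : ∀ w : ℂ, w ≠ 1 - ρ → dsl riemannZeta₁ (1 - ρ) n w = riemannZeta₁ w / (w - (1 - ρ)) ^ n)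
include hdsl'

/-- `h_{L,n}` off the base point. [folklore] -/
theorem partLn_eq {yv : ℝ} {s : ℂ} (hs : s ≠ ρ) :
    partLn yv ρ n s = (yv : ℂ) ^ s * riemannZeta₁ (1 - s) / ((s - 1) ^ 5 * (s - ρ) ^ n) := by
  have hw : 1 - s ≠ 1 - ρ := fun h ↦ hs (sub_right_injective h)
  have hsρ : (s - ρ) ^ n ≠ 0 := pow_ne_zero _ (sub_ne_zero.2 hs)
  have hn1 : (-1 : ℂ) ^ n ≠ 0 := pow_ne_zero _ (by norm_num)
  have e1 : (1 - s) - (1 - ρ) = -(s - ρ) := by ring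
  rw [partLn, hdsl' (1 - s) hw, e1, neg_pow (s - ρ) n]
  rw [show (-1 : ℂ) ^ n * (riemannZeta₁ (1 - s) / ((-1) ^ n * (s - ρ) ^ n)) =
    riemannZeta₁ (1 - s) / (s - ρ) ^ n by field_simp]
  rw [← mul_div_assoc, div_div, mul_comm ((s - ρ) ^ n)]

/-- `h_{L,n}` in terms of `ζ`: `y^s (-s) ζ(1-s)/((s-1)⁵(s-ρ)^n)` for `s ≠ ρ, 0`. [folklore] -/
theorem partLn_eq_zeta {yv : ℝ} {s : ℂ} (hs : s ≠ ρ) (hs0 : s ≠ 0) :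
    partLn yv ρ n s = (yv : ℂ) ^ s * (-s * riemannZeta (1 - s)) / ((s - 1) ^ 5 * (s - ρ) ^ n) := by
  rw [partLn_eq hdsl' hs, riemannZeta₁_one_sub hs0]

omit hdsl' in
/-- `h_{L,n}` is complex differentiable away from `s = 1` (for `y > 0`). [folklore] -/
theorem differentiableAt_partLn {yv : ℝ} (hyv : 0 < yv) (ρ : ℂ) (n : ℕ) {s : ℂ} (hs : s ≠ 1) :
    DifferentiableAt ℂ (partLn yv ρ n) s := by
  unfold partLn
  refine DifferentiableAt.div (DifferentiableAt.mul ?_ (DifferentiableAt.mul (by fun_prop) ?_))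
    (by fun_prop) (pow_ne_zero _ (sub_ne_zero.2 hs))
  · exact differentiableAt_id.const_cpow (Or.inl (by exact_mod_cast hyv.ne'))
  · have hd : Differentiable ℂ (dsl riemannZeta₁ (1 - ρ) n) := fun w ↦
      (analyticOnNhd_dsl analyticOnNhd_riemannZeta₁ (1 - ρ) n w (Set.mem_univ w)).differentiableAt
    exact (hd.comp (by fun_prop : Differentiable ℂ fun z : ℂ ↦ 1 - z)) s

/-- **Decay of `h_{L,n}`** (`n ≥ 1`): for `y ≥ 1`, `re s ≤ 1`, `‖s‖ ≥ max 4 (2‖ρ‖)`: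
`‖h_{L,n}(s)‖ ≤ 1024 y/‖s‖²`. [folklore] -/
theorem norm_partLn_le (hn : 1 ≤ n) {yv : ℝ} (hyv : 1 ≤ yv)
    (hρ : ρ ≠ 0) {s : ℂ} (hs1 : s.re ≤ 1) (hs : max 4 (2 * ‖ρ‖) ≤ ‖s‖) :
    ‖partLn yv ρ n s‖ ≤ 1024 * yv / ‖s‖ ^ 2 := by
  have h4 : 4 ≤ ‖s‖ := le_of_max_le_left hs
  have h2ρ : 2 * ‖ρ‖ ≤ ‖s‖ := le_of_max_le_right hs
  have hρpos : 0 < ‖ρ‖ := norm_pos_iff.2 hρ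
  have hsρ : s ≠ ρ := by
    intro h; rw [h] at h2ρ; linarith
  have hspos : 0 < ‖s‖ := by linarith
  have hyv0 : 0 < yv := by linarith
  rw [partLn_eq hdsl' hsρ, norm_div, norm_mul, norm_mul, norm_pow, norm_pow,
    norm_cpow_eq_rpow_re_of_pos hyv0]
  have hys : yv ^ s.re ≤ yv := by
    calc yv ^ s.re ≤ yv ^ (1 : ℝ) := Real.rpow_le_rpow_of_exponent_le hyv hs1
      _ = yv := Real.rpow_one yv
  have hζ1 : ‖riemannZeta₁ (1 - s)‖ ≤ (‖s‖ + 3) ^ 4 := by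
    refine (norm_riemannZeta₁_le (by simp; linarith)).trans ?_
    have : ‖1 - s‖ ≤ ‖s‖ + 1 := (norm_sub_le _ _).trans (by simp; linarith)
    exact pow_le_pow_left₀ (by positivity) (by linarith) 4
  have hζ2 : (‖s‖ + 3) ^ 4 ≤ 16 * ‖s‖ ^ 4 := by
    have : ‖s‖ + 3 ≤ 2 * ‖s‖ := by linarith
    calc (‖s‖ + 3) ^ 4 ≤ (2 * ‖s‖) ^ 4 := pow_le_pow_left₀ (by positivity) this 4
      _ = 16 * ‖s‖ ^ 4 := by ring
  have hsub : ‖s‖ / 2 ≤ ‖s - ρ‖ := by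
    have h' : ‖s‖ - ‖ρ‖ ≤ ‖s - ρ‖ := by
      linarith [abs_norm_sub_norm_le s ρ, le_abs_self (‖s‖ - ‖ρ‖)]
    linarith
  have hsubn : ‖s - ρ‖ ≤ ‖s - ρ‖ ^ n := le_self_pow₀ (by linarith) (by omega)
  have hsub1 : ‖s‖ / 2 ≤ ‖s - 1‖ := by
    have h' : ‖s‖ - ‖(1 : ℂ)‖ ≤ ‖s - 1‖ := by
      linarith [abs_norm_sub_norm_le s 1, le_abs_self (‖s‖ - ‖(1 : ℂ)‖)]
    rw [norm_one] at h'
    linarith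
  have hsρpos : 0 < ‖s - ρ‖ ^ n := pow_pos (by linarith) n
  have hs1pos : 0 < ‖s - 1‖ := by linarith
  rw [div_le_div_iff₀ (mul_pos (pow_pos hs1pos 5) hsρpos) (pow_pos hspos 2)]
  have key : (‖s‖ / 2) ^ 5 * (‖s‖ / 2) ≤ ‖s - 1‖ ^ 5 * ‖s - ρ‖ ^ n := by
    gcongr; exact hsub.trans hsubn
  calc yv ^ s.re * ‖riemannZeta₁ (1 - s)‖ * ‖s‖ ^ 2 ≤ yv * (16 * ‖s‖ ^ 4) * ‖s‖ ^ 2 := by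
        gcongr; exact hζ1.trans hζ2
    _ = 1024 * yv * ((‖s‖ / 2) ^ 5 * (‖s‖ / 2)) := by ring
    _ ≤ 1024 * yv * (‖s - 1‖ ^ 5 * ‖s - ρ‖ ^ n) := by gcongr

/-- `h_{L,n}` is integrable along every line `re s = σ < 1` (for `y ≥ 1`, `n ≥ 1`). [folklore] -/
theorem integrable_partLn_line (hn : 1 ≤ n) {yv : ℝ} (hyv : 1 ≤ yv)
    (hρ : ρ ≠ 0) {σ : ℝ} (hσ : σ < 1) :
    Integrable fun y : ℝ ↦ partLn yv ρ n ((σ : ℂ) + y * I) := by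
  have hcont : Continuous fun y : ℝ ↦ partLn yv ρ n ((σ : ℂ) + y * I) :=
    continuous_line_of_differentiableAt σ fun y ↦ differentiableAt_partLn (by linarith) ρ n fun h ↦ by
      have := congrArg Complex.re h; simp at this; linarith
  refine integrable_of_continuous_of_norm_le hcont (T := max 4 (2 * ‖ρ‖)) (C := 2 * (1024 * yv))
    fun y hy ↦ ?_
  exact norm_le_inv_one_add_sq_of_le (by positivity) (le_trans (by norm_num) (le_max_left _ _))
    (fun hs ↦ norm_partLn_le hdsl' hn hyv hρ (by simp; linarith) hs) hy

/-- **Shifting `h_{L,n}` from the critical line to `re s = -1`**. [folklore] -/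
theorem integral_partLn_half_eq_neg_one (hn : 1 ≤ n) {yv : ℝ} (hyv : 1 ≤ yv)
    (hρ : ρ.re = 1 / 2) :
    ∫ y : ℝ, partLn yv ρ n (((1 / 2 : ℝ) : ℂ) + y * I) = ∫ y : ℝ, partLn yv ρ n (((-1 : ℝ) : ℂ) + y * I) := by
  have hρ0 := ne_zero_of_re_eq_half hρ
  symm
  refine Literature.Analysis.Complex.integral_vertical_eq_of_differentiableOn (by norm_num) ?_
    (integrable_partLn_line hdsl' hn hyv hρ0 (by norm_num))
    (integrable_partLn_line hdsl' hn hyv hρ0 (by norm_num)) ?_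
  · intro s hs
    refine (differentiableAt_partLn (by linarith) ρ n fun h ↦ ?_).differentiableWithinAt
    have h1 : s.re ≤ 1 / 2 := hs.2
    rw [h, one_re] at h1
    norm_num at h1
  · exact horizontal_decay_of_le (le_trans (by norm_num) (le_max_left 4 (2 * ‖ρ‖)))
      fun s _ hb hs ↦ norm_partLn_le hdsl' hn hyv hρ0 (by linarith) hs

omit hdsl' in
/-- `q_{L,n}` is complex differentiable away from `1` and `ρ`. [folklore] -/
theorem differentiableAt_qLn {s : ℂ} (hs1 : s ≠ 1) (hsρ : s ≠ ρ) :
    DifferentiableAt ℂ (qLn ρ n) s := by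
  unfold qLn
  exact DifferentiableAt.div (by fun_prop) (by fun_prop)
    (mul_ne_zero (pow_ne_zero _ (sub_ne_zero.2 hs1)) (pow_ne_zero _ (sub_ne_zero.2 hsρ)))

omit hdsl' in
/-- `q_{L,n}` is complex differentiable on `re s ≤ -1`. [folklore] -/
theorem differentiableOn_qLn (hρ : ρ.re = 1 / 2) :
    DifferentiableOn ℂ (qLn ρ n) {s : ℂ | s.re ≤ -1} := by
  intro s hs
  simp only [mem_setOf_eq] at hs
  have hs1 : s ≠ 1 := fun h ↦ by rw [h] at hs; simp at hs; linarith
  have hsρ : s ≠ ρ := fun h ↦ by rw [h, hρ] at hs; norm_num at hs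
  exact (differentiableAt_qLn hs1 hsρ).differentiableWithinAt

omit hdsl' in
/-- `‖q_{L,n}(s)‖ ≤ 1/‖s‖²` on `re s ≤ -1` (`n ≥ 1`). [folklore] -/
theorem norm_qLn_le (hn : 1 ≤ n) (hρ : ρ.re = 1 / 2) {s : ℂ} (hs : s.re ≤ -1) :
    ‖qLn ρ n s‖ ≤ 1 / ‖s‖ ^ 2 := by
  have hns : 1 ≤ ‖s‖ := by
    have := abs_re_le_norm s
    have h' : 1 ≤ |s.re| := by rw [abs_of_nonpos (by linarith)]; linarith
    linarith
  have hspos : 0 < ‖s‖ := by linarith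
  have hsρ : 3 / 2 ≤ ‖s - ρ‖ := by
    have := abs_re_le_norm (s - ρ)
    rw [sub_re, hρ, abs_of_nonpos (by linarith)] at this
    linarith
  have hsρn : ‖s - ρ‖ ≤ ‖s - ρ‖ ^ n := le_self_pow₀ (by linarith) (by omega)
  have h1 : ‖s‖ ≤ ‖s - 1‖ := by
    have e1 : ‖s‖ ^ 2 = s.re ^ 2 + s.im ^ 2 := by rw [Complex.sq_norm, Complex.normSq_apply]; ring
    have e2 : ‖s - 1‖ ^ 2 = (s.re - 1) ^ 2 + s.im ^ 2 := by
      rw [Complex.sq_norm, Complex.normSq_apply]; simp; ring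
    nlinarith [norm_nonneg (s - 1), norm_nonneg s]
  rw [qLn, norm_div, norm_mul, norm_pow, norm_pow,
    div_le_div_iff₀ (mul_pos (pow_pos (by linarith) 5) (by positivity)) (pow_pos hspos 2), one_mul]
  have h5 : ‖s‖ ^ 5 ≤ ‖s - 1‖ ^ 5 := pow_le_pow_left₀ (norm_nonneg _) h1 5
  calc ‖s‖ * ‖s‖ ^ 2 = ‖s‖ ^ 3 := by ring
    _ ≤ ‖s‖ ^ 3 * (‖s‖ ^ 2 * (3 / 2)) := by
        have : 1 ≤ ‖s‖ ^ 2 * (3 / 2) := by nlinarith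
        nlinarith [pow_pos hspos 3]
    _ = ‖s‖ ^ 5 * (3 / 2) := by ring
    _ ≤ ‖s - 1‖ ^ 5 * ‖s - ρ‖ ^ n := by gcongr; exact hsρ.trans hsρn

omit hdsl' in
/-- Arithmetic of the Dirichlet series of `ζ(1-s)`:
`q_{L,n}(s) · (-(1/(m+1)) (y(m+1))^s) = y^s (-s) (1/(m+1)^{1-s}) / ((s-1)⁵(s-ρ)^n)`. [folklore] -/
lemma qLn_term_eq {yv : ℝ} (hyv : 0 ≤ yv) (ρ s : ℂ) (m : ℕ) :
    qLn ρ n s * (-(1 / ((m : ℂ) + 1)) * ((yv * (m + 1) : ℝ) : ℂ) ^ s) =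
      (yv : ℂ) ^ s * (-s) * (1 / ((m : ℂ) + 1) ^ (1 - s)) / ((s - 1) ^ 5 * (s - ρ) ^ n) := by
  have hm : ((m : ℂ) + 1) ≠ 0 := by exact_mod_cast Nat.succ_ne_zero m
  have e1 : ((yv * (m + 1) : ℝ) : ℂ) ^ s = (yv : ℂ) ^ s * ((m : ℂ) + 1) ^ s := by
    rw [show ((yv * (m + 1) : ℝ) : ℂ) = (yv : ℂ) * ((m + 1 : ℝ) : ℂ) by push_cast; ring,
      mul_cpow_ofReal_nonneg hyv (by positivity)]
    push_cast
    ring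
  have e2 : 1 / ((m : ℂ) + 1) ^ (1 - s) = ((m : ℂ) + 1) ^ s / ((m : ℂ) + 1) := by
    rw [cpow_sub _ _ hm, cpow_one]
    field_simp
  rw [e1, e2, qLn]
  field_simp

/-- **`h_{L,n}` on `re s = -1` as an absolutely convergent series**. [folklore] -/
theorem partLn_neg_one_eq_tsum {yv : ℝ} (hyv : 0 < yv) (hρ : ρ.re = 1 / 2) (y : ℝ) :
    partLn yv ρ n (((-1 : ℝ) : ℂ) + y * I) =
      ∑' m : ℕ, qLn ρ n (((-1 : ℝ) : ℂ) + y * I) *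
        (-(1 / ((m : ℂ) + 1)) * ((yv * (m + 1) : ℝ) : ℂ) ^ (((-1 : ℝ) : ℂ) + y * I)) := by
  set s : ℂ := ((-1 : ℝ) : ℂ) + y * I with hsdef
  have hsre : s.re = -1 := by simp [hsdef]
  have hsρ : s ≠ ρ := fun h ↦ by rw [h] at hsre; rw [hρ] at hsre; norm_num at hsre
  have hs0 : s ≠ 0 := fun h ↦ by rw [h] at hsre; simp at hsre
  rw [partLn_eq_zeta hdsl' hsρ hs0,
    zeta_eq_tsum_one_div_nat_add_one_cpow (by simp [hsre])]
  simp_rw [qLn_term_eq hyv.le]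
  rw [tsum_div_const]
  congr 1
  rw [← tsum_mul_left, ← tsum_mul_left]
  exact tsum_congr fun m ↦ by ring

omit hdsl' in
/-- The terms of the series for `h_{L,n}` on `re s = -1` are integrable, with summable
`L¹`-norms. [folklore] -/
theorem integrable_qLn_mul (hn : 1 ≤ n) {yv : ℝ} (hyv : 1 ≤ yv) (hρ : ρ.re = 1 / 2) (m : ℕ) :
    Integrable (fun y : ℝ ↦ qLn ρ n (((-1 : ℝ) : ℂ) + y * I) *
      (-(1 / ((m : ℂ) + 1)) * ((yv * (m + 1) : ℝ) : ℂ) ^ (((-1 : ℝ) : ℂ) + y * I))) ∧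
      ∫ y : ℝ, ‖qLn ρ n (((-1 : ℝ) : ℂ) + y * I) *
        (-(1 / ((m : ℂ) + 1)) * ((yv * (m + 1) : ℝ) : ℂ) ^ (((-1 : ℝ) : ℂ) + y * I))‖ ≤
        (1 / (yv * (m + 1) ^ 2)) * π := by
  have hx : 0 < yv * (m + 1) := by positivity
  have hm : ‖-(1 / ((m : ℂ) + 1))‖ = 1 / (m + 1) := by
    rw [norm_neg, norm_div, norm_one, show ((m : ℂ) + 1) = ((m + 1 : ℝ) : ℂ) by push_cast; ring,
      Complex.norm_real, Real.norm_eq_abs, abs_of_pos (by positivity)]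
  have hbound : ∀ y : ℝ, ‖qLn ρ n (((-1 : ℝ) : ℂ) + y * I) *
      (-(1 / ((m : ℂ) + 1)) * ((yv * (m + 1) : ℝ) : ℂ) ^ (((-1 : ℝ) : ℂ) + y * I))‖ ≤
      (1 / (yv * (m + 1) ^ 2)) * (1 + y ^ 2)⁻¹ := by
    intro y
    have hre : (((-1 : ℝ) : ℂ) + y * I).re = -1 := by simp
    rw [norm_mul, norm_mul, norm_cpow_eq_rpow_re_of_pos hx, hre, hm,
      Real.rpow_neg_one]
    have hq := norm_qLn_le hn hρ (s := ((-1 : ℝ) : ℂ) + y * I) (by rw [hre])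
    have hns : ‖((-1 : ℝ) : ℂ) + y * I‖ ^ 2 = 1 + y ^ 2 := by
      rw [Complex.sq_norm, normSq_add_mul_I]; ring
    rw [hns] at hq
    calc ‖qLn ρ n (((-1 : ℝ) : ℂ) + y * I)‖ * (1 / (m + 1) * (yv * (m + 1))⁻¹)
        ≤ 1 / (1 + y ^ 2) * (1 / (m + 1) * (yv * (m + 1))⁻¹) := by gcongr
      _ = (1 / (yv * (m + 1) ^ 2)) * (1 + y ^ 2)⁻¹ := by field_simp
  have hcont : Continuous fun y : ℝ ↦ qLn ρ n (((-1 : ℝ) : ℂ) + y * I) *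
      (-(1 / ((m : ℂ) + 1)) * ((yv * (m + 1) : ℝ) : ℂ) ^ (((-1 : ℝ) : ℂ) + y * I)) := by
    refine Continuous.mul ?_ (Continuous.mul continuous_const ?_)
    · refine continuous_line_of_differentiableAt (-1) fun y ↦ differentiableAt_qLn ?_ ?_
      · intro h; have := congrArg Complex.re h; simp at this; norm_num at this
      · intro h; have := congrArg Complex.re h; rw [hρ] at this; simp at this; norm_num at this
    · exact continuous_line_of_differentiableAt (-1) fun y ↦
        differentiableAt_id.const_cpow (Or.inl (by exact_mod_cast hx.ne'))
  have hint := integrable_of_continuous_of_norm_le hcont (T := 0) fun y _ ↦ hbound y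
  refine ⟨hint, ?_⟩
  calc ∫ y : ℝ, ‖qLn ρ n (((-1 : ℝ) : ℂ) + y * I) *
        (-(1 / ((m : ℂ) + 1)) * ((yv * (m + 1) : ℝ) : ℂ) ^ (((-1 : ℝ) : ℂ) + y * I))‖
      ≤ ∫ y : ℝ, (1 / (yv * (m + 1) ^ 2)) * (1 + y ^ 2)⁻¹ :=
        integral_mono hint.norm (integrable_inv_one_add_sq.const_mul _) hbound
    _ = (1 / (yv * (m + 1) ^ 2)) * π := by rw [integral_const_mul, integral_univ_inv_one_add_sq]

/-- **`∫ h_{L,n} = 0` along the critical line** (`y ≥ 1`, `1 ≤ n ≤ m(1-ρ)`, `re ρ = 1/2`).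
[cite: Burnol2002, Thm. 4.2 (proof)] -/
theorem integral_partLn_eq_zero (hn : 1 ≤ n) {yv : ℝ} (hyv : 1 ≤ yv) (hρ : ρ.re = 1 / 2) :
    ∫ y : ℝ, partLn yv ρ n (((1 / 2 : ℝ) : ℂ) + y * I) = 0 := by
  have hyv0 : 0 < yv := by linarith
  rw [integral_partLn_half_eq_neg_one hdsl' hn hyv hρ]
  simp_rw [partLn_neg_one_eq_tsum hdsl' hyv0 hρ]
  have hsum : Summable fun m : ℕ ↦ ∫ y : ℝ, ‖qLn ρ n (((-1 : ℝ) : ℂ) + y * I) *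
      (-(1 / ((m : ℂ) + 1)) * ((yv * (m + 1) : ℝ) : ℂ) ^ (((-1 : ℝ) : ℂ) + y * I))‖ := by
    have h1 : Summable fun m : ℕ ↦ (1 / (yv * (m + 1) ^ 2)) * π := by
      have := (summable_nat_add_iff 1).2 (Real.summable_one_div_nat_pow.2 one_lt_two)
      simp only [Nat.cast_add, Nat.cast_one] at this
      refine (this.mul_left (π / yv)).congr fun m ↦ ?_
      field_simp
    exact Summable.of_nonneg_of_le (fun m ↦ integral_nonneg fun y ↦ norm_nonneg _)
      (fun m ↦ (integrable_qLn_mul hn hyv hρ m).2) h1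
  rw [← integral_tsum_of_summable_integral_norm (fun m ↦ (integrable_qLn_mul hn hyv hρ m).1) hsum]
  have h0 : ∀ m : ℕ, ∫ y : ℝ, qLn ρ n (((-1 : ℝ) : ℂ) + y * I) *
      (-(1 / ((m : ℂ) + 1)) * ((yv * (m + 1) : ℝ) : ℂ) ^ (((-1 : ℝ) : ℂ) + y * I)) = 0 := by
    intro m
    have hx1 : 1 ≤ yv * (m + 1) := by nlinarith [m.cast_nonneg (α := ℝ)]
    have e : ∀ y : ℝ, qLn ρ n (((-1 : ℝ) : ℂ) + y * I) *
        (-(1 / ((m : ℂ) + 1)) * ((yv * (m + 1) : ℝ) : ℂ) ^ (((-1 : ℝ) : ℂ) + y * I)) =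
        -(1 / ((m : ℂ) + 1)) * (qLn ρ n (((-1 : ℝ) : ℂ) + y * I) *
          ((yv * (m + 1) : ℝ) : ℂ) ^ (((-1 : ℝ) : ℂ) + y * I)) := fun y ↦ by ring
    simp_rw [e]
    rw [integral_const_mul, Literature.Analysis.Complex.integral_vertical_mul_cpow_eq_zero_of_one_le
      (C := 1) (by norm_num) (differentiableOn_qLn hρ) (fun s hs ↦ norm_qLn_le hn hρ hs) hx1, mul_zero]
  simp_rw [h0]
  exact tsum_zero

end partL

/-! ## Orthogonality of `K_k` on the critical line -/

section orthogonality

/-- Powers: `u^j/u^m = 1/u^{m-j}` for `u ≠ 0`, `j ≤ m`. [folklore] -/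
lemma pow_div_pow_eq_one_div {u : ℂ} (hu : u ≠ 0) {j m : ℕ} (h : j ≤ m) :
    u ^ j / u ^ m = 1 / u ^ (m - j) := by
  rw [div_eq_div_iff (pow_ne_zero _ hu) (pow_ne_zero _ hu), one_mul, ← pow_add,
    Nat.add_sub_cancel' h]

/-- **Distributed pole expansion of `K_k`** (`0 < λ < 1`, `s ≠ ρ`):
`K_k = ∑_{j ≤ k} k! c_j · r u^j/u^{k+1} - ∑_{i ≤ k} (k!(-L)^i/i!) · (V(s)/V(ρ)) λ^{ρ-s} r u^i/u^{k+1}`,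
`u = s - ρ`. [folklore] -/
theorem burnolKk_eq_sum_sub_sum {lam : ℝ} (h0 : 0 < lam) (h1 : lam < 1) (ρ : ℂ) (k : ℕ) {s : ℂ}
    (hs : s ≠ ρ) :
    burnolKk ρ k lam s =
      ∑ j ∈ Finset.range (k + 1), (k ! * wCoef ρ j) * (burnolR s * (s - ρ) ^ j / (s - ρ) ^ (k + 1)) -
      ∑ i ∈ Finset.range (k + 1), (k ! * (-(Lof lam : ℂ)) ^ i / i !) *
        (burnolV s / burnolV ρ * (lam : ℂ) ^ (ρ - s) * burnolR s * (s - ρ) ^ i / (s - ρ) ^ (k + 1)) := by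
  rw [burnolKk_eq_pole_expansion h0 h1 ρ k hs, TW, expTrunc]
  simp only [Finset.mul_sum, Finset.sum_div, mul_sub, sub_div]
  congr 1
  · exact Finset.sum_congr rfl fun j _ ↦ by ring
  · refine Finset.sum_congr rfl fun j _ ↦ ?_
    rw [show (-((Lof lam : ℂ) * s - (Lof lam : ℂ) * ρ)) ^ j = (-(Lof lam : ℂ)) ^ j * (s - ρ) ^ j by
      rw [← mul_pow]; congr 1; ring]
    ring

variable {γ τ lam a : ℝ}

/-- **The right pieces**: `(a^{-s}(-ζ(s)/s)) · r(s)/(s-ρ)^n = -h_{R,n}(s)` with `θ = 1/a`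
(`s = 1/2+iτ ≠ ρ = 1/2+iγ`, `a > 0`, `n ≤ m(ρ)`). [cite: Burnol2002, Thm. 4.2 (proof)] -/
theorem mellin_fract_mul_r_div_eq (hτ : τ ≠ γ) (ha : 0 < a) {n : ℕ}
    (hdsl : ∀ s : ℂ, s ≠ (1 / 2 : ℂ) + γ * I →
      dsl riemannZeta₁ ((1 / 2 : ℂ) + γ * I) n s = riemannZeta₁ s / (s - ((1 / 2 : ℂ) + γ * I)) ^ n) :
    ((a : ℂ) ^ (-((1 / 2 : ℂ) + τ * I)) *
        (-riemannZeta ((1 / 2 : ℂ) + τ * I) / ((1 / 2 : ℂ) + τ * I))) *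
      (burnolR ((1 / 2 : ℂ) + τ * I) / (((1 / 2 : ℂ) + τ * I) - ((1 / 2 : ℂ) + γ * I)) ^ n) =
    -partRn (1 / a) ((1 / 2 : ℂ) + γ * I) n ((1 / 2 : ℂ) + τ * I) := by
  set s : ℂ := (1 / 2 : ℂ) + τ * I with hsdef
  set ρ : ℂ := (1 / 2 : ℂ) + γ * I with hρdef
  have hs0 : s ≠ 0 := line_ne_zero τ
  have hs1 : s ≠ 1 := line_ne_one τ
  have hsρ : s ≠ ρ := fun h ↦ hτ (by
    have := congrArg Complex.im h; simpa [hsdef, hρdef] using this)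
  have hsρ' : (s - ρ) ^ n ≠ 0 := pow_ne_zero _ (sub_ne_zero.2 hsρ)
  have hA : (a : ℂ) ^ s ≠ 0 := fun h ↦ by
    rw [cpow_eq_zero_iff] at h; exact (ofReal_ne_zero.2 ha.ne') h.1
  have e1 : (a : ℂ) ^ (-s) = ((a : ℂ) ^ s)⁻¹ := cpow_neg _ _
  have e2 : ((1 / a : ℝ) : ℂ) ^ s = ((a : ℂ) ^ s)⁻¹ := one_div_cpow_ofReal ha s
  rw [partRn_eq_zeta hdsl hsρ hs1, burnolR, e1, e2]
  field_simp

/-- **The left pieces**: `(a^{-s}(-ζ(s)/s)) · (V(s)/V(ρ)) λ^{ρ-s} r(s)/(s-ρ)^n = (λ^ρ/V(ρ)) h_{L,n}(s)`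
with `y = 1/(aλ)` (`s ≠ ρ` on the line, `a, λ > 0`, `n ≤ m(1-ρ)`; functional equation
`ζ(1-s) = gammaRatio(s)ζ(s)`). [cite: Burnol2002, Thm. 4.2 (proof)] -/
theorem mellin_fract_mul_E_r_div_eq (hτ : τ ≠ γ) (hlam : 0 < lam) (ha : 0 < a) {n : ℕ}
    (hdsl' : ∀ w : ℂ, w ≠ 1 - ((1 / 2 : ℂ) + γ * I) →
      dsl riemannZeta₁ (1 - ((1 / 2 : ℂ) + γ * I)) n w =
        riemannZeta₁ w / (w - (1 - ((1 / 2 : ℂ) + γ * I))) ^ n) :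
    ((a : ℂ) ^ (-((1 / 2 : ℂ) + τ * I)) *
        (-riemannZeta ((1 / 2 : ℂ) + τ * I) / ((1 / 2 : ℂ) + τ * I))) *
      (burnolV ((1 / 2 : ℂ) + τ * I) / burnolV ((1 / 2 : ℂ) + γ * I) *
        (lam : ℂ) ^ (((1 / 2 : ℂ) + γ * I) - ((1 / 2 : ℂ) + τ * I)) * burnolR ((1 / 2 : ℂ) + τ * I) /
        (((1 / 2 : ℂ) + τ * I) - ((1 / 2 : ℂ) + γ * I)) ^ n) =
    ((lam : ℂ) ^ ((1 / 2 : ℂ) + γ * I) / burnolV ((1 / 2 : ℂ) + γ * I)) *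
      partLn (1 / (a * lam)) ((1 / 2 : ℂ) + γ * I) n ((1 / 2 : ℂ) + τ * I) := by
  set s : ℂ := (1 / 2 : ℂ) + τ * I with hsdef
  set ρ : ℂ := (1 / 2 : ℂ) + γ * I with hρdef
  have hs0 : s ≠ 0 := line_ne_zero τ
  have hs1 : s ≠ 1 := line_ne_one τ
  have hs1' : s - 1 ≠ 0 := sub_ne_zero.2 hs1
  have hsρ : s ≠ ρ := fun h ↦ hτ (by
    have := congrArg Complex.im h; simpa [hsdef, hρdef] using this)
  have hsρ' : (s - ρ) ^ n ≠ 0 := pow_ne_zero _ (sub_ne_zero.2 hsρ)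
  have hVρ : burnolV ρ ≠ 0 := burnolV_ne_zero (by simp [hρdef]) (by simp [hρdef]; norm_num)
  have hA : (a : ℂ) ^ s ≠ 0 := fun h ↦ by
    rw [cpow_eq_zero_iff] at h; exact (ofReal_ne_zero.2 ha.ne') h.1
  have hL : (lam : ℂ) ^ s ≠ 0 := fun h ↦ by
    rw [cpow_eq_zero_iff] at h; exact (ofReal_ne_zero.2 hlam.ne') h.1
  have e1 : (a : ℂ) ^ (-s) = ((a : ℂ) ^ s)⁻¹ := cpow_neg _ _
  have e3 : ((1 / (a * lam) : ℝ) : ℂ) ^ s = ((a : ℂ) ^ s)⁻¹ * ((lam : ℂ) ^ s)⁻¹ := by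
    rw [show (1 / (a * lam) : ℝ) = (1 / a) * (1 / lam) by field_simp,
      show (((1 / a) * (1 / lam) : ℝ) : ℂ) = ((1 / a : ℝ) : ℂ) * ((1 / lam : ℝ) : ℂ) by push_cast; ring,
      mul_cpow_ofReal_nonneg (by positivity) (by positivity), one_div_cpow_ofReal ha,
      one_div_cpow_ofReal hlam]
  have e4 : (lam : ℂ) ^ (ρ - s) = (lam : ℂ) ^ ρ / (lam : ℂ) ^ s :=
    cpow_sub _ _ (ofReal_ne_zero.2 hlam.ne')
  have hFE : riemannZeta (1 - s) = gammaRatio s * riemannZeta s :=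
    riemannZeta_one_sub_eq (by simp [hsdef]) (by simp [hsdef]; norm_num)
  have hVs : burnolV s = gammaRatio s * (s / (s - 1)) ^ 6 := rfl
  rw [partLn_eq_zeta hdsl' hsρ hs0, burnolR, hVs, e1, e3, e4, hFE]
  field_simp

/-- The divided-difference hypotheses at `ρ` from the multiplicity: for a zero `ρ = 1/2+iγ` with
`k < m(ρ)`, `dsl ζ₁ ρ n = ζ₁/(s-ρ)^n` off `ρ` for all `n ≤ k+1`. [folklore] -/
theorem dsl_hyp_of_lt_order {k : ℕ} (hk : (k : ℤ) < riemannZetaZeroOrder ((1 / 2 : ℂ) + γ * I))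
    {n : ℕ} (hn : n ≤ k + 1) :
    ∀ s : ℂ, s ≠ (1 / 2 : ℂ) + γ * I →
      dsl riemannZeta₁ ((1 / 2 : ℂ) + γ * I) n s = riemannZeta₁ s / (s - ((1 / 2 : ℂ) + γ * I)) ^ n :=
  fun _ hs ↦ dsl_riemannZeta₁_eq_div (line_ne_one γ) (by omega) hs

/-- The same at `1 - ρ` (`m(1-ρ) = m(ρ)` on the line). [folklore] -/
theorem dsl_hyp_one_sub_of_lt_order {k : ℕ}
    (hk : (k : ℤ) < riemannZetaZeroOrder ((1 / 2 : ℂ) + γ * I)) {n : ℕ} (hn : n ≤ k + 1) :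
    ∀ w : ℂ, w ≠ 1 - ((1 / 2 : ℂ) + γ * I) →
      dsl riemannZeta₁ (1 - ((1 / 2 : ℂ) + γ * I)) n w =
        riemannZeta₁ w / (w - (1 - ((1 / 2 : ℂ) + γ * I))) ^ n := by
  intro w hw
  have h1 : 1 - ((1 / 2 : ℂ) + γ * I) ≠ 1 := by
    rw [Ne, sub_eq_self]; exact line_ne_zero γ
  refine dsl_riemannZeta₁_eq_div h1 ?_ hw
  rw [riemannZetaZeroOrder_one_sub_line]
  omega

/-- **The pointwise identity on the critical line** for `K_k` (zero `ρ = 1/2+iγ` with `k < m(ρ)`,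
`s = 1/2+iτ ≠ ρ`, `0 < λ < 1`, `a > 0`): `(a^{-s}(-ζ(s)/s)) · K_k(s)` is the finite combination
`∑_j (-k! c_j) h_{R,k+1-j}(s) + ∑_i (-(k!(-L)^i/i!) λ^ρ/V(ρ)) h_{L,k+1-i}(s)`.
[cite: Burnol2002, Thm. 4.2 (proof)] -/
theorem mellin_fract_mul_burnolKk_eq {k : ℕ}
    (hk : (k : ℤ) < riemannZetaZeroOrder ((1 / 2 : ℂ) + γ * I)) (hτ : τ ≠ γ)
    (hlam0 : 0 < lam) (hlam1 : lam < 1) (ha : 0 < a) :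
    ((a : ℂ) ^ (-((1 / 2 : ℂ) + τ * I)) *
        (-riemannZeta ((1 / 2 : ℂ) + τ * I) / ((1 / 2 : ℂ) + τ * I))) *
      burnolKk ((1 / 2 : ℂ) + γ * I) k lam ((1 / 2 : ℂ) + τ * I) =
    ∑ j ∈ Finset.range (k + 1), (-(k ! * wCoef ((1 / 2 : ℂ) + γ * I) j)) *
        partRn (1 / a) ((1 / 2 : ℂ) + γ * I) (k + 1 - j) ((1 / 2 : ℂ) + τ * I) +
      ∑ i ∈ Finset.range (k + 1), (-(k ! * (-(Lof lam : ℂ)) ^ i / i ! *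
          ((lam : ℂ) ^ ((1 / 2 : ℂ) + γ * I) / burnolV ((1 / 2 : ℂ) + γ * I)))) *
        partLn (1 / (a * lam)) ((1 / 2 : ℂ) + γ * I) (k + 1 - i) ((1 / 2 : ℂ) + τ * I) := by
  set s : ℂ := (1 / 2 : ℂ) + τ * I with hsdef
  set ρ : ℂ := (1 / 2 : ℂ) + γ * I with hρdef
  set M : ℂ := (a : ℂ) ^ (-s) * (-riemannZeta s / s) with hMdef
  have hsρ : s ≠ ρ := fun h ↦ hτ (by
    have := congrArg Complex.im h; simpa [hsdef, hρdef] using this)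
  have hu : s - ρ ≠ 0 := sub_ne_zero.2 hsρ
  -- the basic pieces, with `u^j/u^{k+1} = 1/u^{k+1-j}`
  have hR : ∀ j ∈ Finset.range (k + 1),
      M * (burnolR s * (s - ρ) ^ j / (s - ρ) ^ (k + 1)) = -partRn (1 / a) ρ (k + 1 - j) s := by
    intro j hj
    have hjk : j ≤ k + 1 := (Finset.mem_range.1 hj).le
    rw [mul_div_assoc, pow_div_pow_eq_one_div hu hjk, mul_one_div]
    exact mellin_fract_mul_r_div_eq hτ ha (dsl_hyp_of_lt_order hk (Nat.sub_le _ _))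
  have hLft : ∀ i ∈ Finset.range (k + 1),
      M * (burnolV s / burnolV ρ * (lam : ℂ) ^ (ρ - s) * burnolR s * (s - ρ) ^ i / (s - ρ) ^ (k + 1)) =
        ((lam : ℂ) ^ ρ / burnolV ρ) * partLn (1 / (a * lam)) ρ (k + 1 - i) s := by
    intro i hi
    have hik : i ≤ k + 1 := (Finset.mem_range.1 hi).le
    rw [mul_div_assoc, pow_div_pow_eq_one_div hu hik, mul_one_div]
    exact mellin_fract_mul_E_r_div_eq hτ hlam0 ha (dsl_hyp_one_sub_of_lt_order hk (Nat.sub_le _ _))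
  rw [burnolKk_eq_sum_sub_sum hlam0 hlam1 ρ k hsρ, mul_sub, Finset.mul_sum, Finset.mul_sum,
    sub_eq_add_neg, ← Finset.sum_neg_distrib]
  congr 1
  · refine Finset.sum_congr rfl fun j hj ↦ ?_
    rw [← mul_assoc, mul_comm M, mul_assoc, hR j hj]
    ring
  · refine Finset.sum_congr rfl fun i hi ↦ ?_
    rw [← mul_assoc, mul_comm M, mul_assoc, hLft i hi]
    ring

/-- **Integrability of `𝓜[{1/(at)}](s) · K_k(s)` on the critical line** (it is a.e. the above
finite combination of integrable functions). [folklore] -/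
theorem integrable_mellin_fract_mul_burnolKk {k : ℕ}
    (hk : (k : ℤ) < riemannZetaZeroOrder ((1 / 2 : ℂ) + γ * I))
    (hlam0 : 0 < lam) (hlam1 : lam < 1) (ha : 1 ≤ a) (ha' : a ≤ 1 / lam) :
    Integrable fun τ : ℝ ↦ ((a : ℂ) ^ (-((1 / 2 : ℂ) + τ * I)) *
        (-riemannZeta ((1 / 2 : ℂ) + τ * I) / ((1 / 2 : ℂ) + τ * I))) *
      burnolKk ((1 / 2 : ℂ) + γ * I) k lam ((1 / 2 : ℂ) + τ * I) := by
  set ρ : ℂ := (1 / 2 : ℂ) + γ * I with hρdef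
  have ha0 : 0 < a := by linarith
  have hρre : ρ.re = 1 / 2 := by simp [hρdef]
  have hρ0 : ρ ≠ 0 := line_ne_zero γ
  have hθ : 0 < 1 / a := by positivity
  have hθ1 : 1 / a ≤ 1 := by rw [div_le_one ha0]; exact ha
  have hy : 1 ≤ 1 / (a * lam) := by
    rw [le_div_iff₀ (by positivity), one_mul]
    calc a * lam ≤ (1 / lam) * lam := by gcongr
      _ = 1 := by field_simp
  have hRi : ∀ j ∈ Finset.range (k + 1), Integrable fun τ : ℝ ↦
      (-(k ! * wCoef ρ j)) * partRn (1 / a) ρ (k + 1 - j) ((1 / 2 : ℂ) + τ * I) := by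
    intro j hj
    have hn : 1 ≤ k + 1 - j := by have := Finset.mem_range.1 hj; omega
    have h := integrable_partRn_line (dsl_hyp_of_lt_order hk (Nat.sub_le _ _)) hn hθ hθ1 hρ0
      (σ := 1 / 2) (by norm_num)
    simp only [ofReal_one_half] at h
    exact h.const_mul _
  have hLi : ∀ i ∈ Finset.range (k + 1), Integrable fun τ : ℝ ↦
      (-(k ! * (-(Lof lam : ℂ)) ^ i / i ! * ((lam : ℂ) ^ ρ / burnolV ρ))) *
        partLn (1 / (a * lam)) ρ (k + 1 - i) ((1 / 2 : ℂ) + τ * I) := by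
    intro i hi
    have hn : 1 ≤ k + 1 - i := by have := Finset.mem_range.1 hi; omega
    have h := integrable_partLn_line (dsl_hyp_one_sub_of_lt_order hk (Nat.sub_le _ _)) hn hy hρ0
      (σ := 1 / 2) (by norm_num)
    simp only [ofReal_one_half] at h
    exact h.const_mul _
  refine ((integrable_finsetSum _ hRi).add (integrable_finsetSum _ hLi)).congr ?_
  filter_upwards [ae_ne γ] with τ hτ
  simp only [Pi.add_apply]
  exact (mellin_fract_mul_burnolKk_eq hk hτ hlam0 hlam1 ha0).symm

/-- **Orthogonality of the `k`-th vector (Burnol, Thm. 4.2 / Cor. 4.3, on the Mellin side).** For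
a zero `ρ = 1/2 + iγ` of `ζ` of multiplicity `m(ρ) > k`, `0 < λ < 1` and `1 ≤ a ≤ 1/λ`:
`∫ a^{-s} (-ζ(s)/s) · K_k(s) dτ = 0` (`s = 1/2 + iτ`); `a^{-s}(-ζ(s)/s)` is the Mellin transform of
the Beurling function `t ↦ {1/(at)}`, so by the Parseval pairing the vector
`𝓜⁻¹(conj ∘ K_k)` is orthogonal in `L²(0,∞)` to every generator of `𝓑_λ` ("`Y^λ_{s,k}` is
perpendicular to `𝓒_λ` if and only if … `s` is a zero `ρ` of the zeta function and `k < m_ρ`").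
[cite: Burnol2002, Thm. 4.2 and Cor. 4.3] -/
theorem integral_mellin_fract_mul_burnolKk_eq_zero {k : ℕ}
    (hk : (k : ℤ) < riemannZetaZeroOrder ((1 / 2 : ℂ) + γ * I))
    (hlam0 : 0 < lam) (hlam1 : lam < 1) (ha : 1 ≤ a) (ha' : a ≤ 1 / lam) :
    ∫ τ : ℝ, ((a : ℂ) ^ (-((1 / 2 : ℂ) + τ * I)) *
        (-riemannZeta ((1 / 2 : ℂ) + τ * I) / ((1 / 2 : ℂ) + τ * I))) *
      burnolKk ((1 / 2 : ℂ) + γ * I) k lam ((1 / 2 : ℂ) + τ * I) = 0 := by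
  set ρ : ℂ := (1 / 2 : ℂ) + γ * I with hρdef
  have ha0 : 0 < a := by linarith
  have hρre : ρ.re = 1 / 2 := by simp [hρdef]
  have hρ0 : ρ ≠ 0 := line_ne_zero γ
  have hθ : 0 < 1 / a := by positivity
  have hθ1 : 1 / a ≤ 1 := by rw [div_le_one ha0]; exact ha
  have hy : 1 ≤ 1 / (a * lam) := by
    rw [le_div_iff₀ (by positivity), one_mul]
    calc a * lam ≤ (1 / lam) * lam := by gcongr
      _ = 1 := by field_simp
  have hRi : ∀ j ∈ Finset.range (k + 1), Integrable fun τ : ℝ ↦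
      (-(k ! * wCoef ρ j)) * partRn (1 / a) ρ (k + 1 - j) ((1 / 2 : ℂ) + τ * I) := by
    intro j hj
    have hn : 1 ≤ k + 1 - j := by have := Finset.mem_range.1 hj; omega
    have h := integrable_partRn_line (dsl_hyp_of_lt_order hk (Nat.sub_le _ _)) hn hθ hθ1 hρ0
      (σ := 1 / 2) (by norm_num)
    simp only [ofReal_one_half] at h
    exact h.const_mul _
  have hLi : ∀ i ∈ Finset.range (k + 1), Integrable fun τ : ℝ ↦
      (-(k ! * (-(Lof lam : ℂ)) ^ i / i ! * ((lam : ℂ) ^ ρ / burnolV ρ))) *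
        partLn (1 / (a * lam)) ρ (k + 1 - i) ((1 / 2 : ℂ) + τ * I) := by
    intro i hi
    have hn : 1 ≤ k + 1 - i := by have := Finset.mem_range.1 hi; omega
    have h := integrable_partLn_line (dsl_hyp_one_sub_of_lt_order hk (Nat.sub_le _ _)) hn hy hρ0
      (σ := 1 / 2) (by norm_num)
    simp only [ofReal_one_half] at h
    exact h.const_mul _
  have hR0 : ∀ j ∈ Finset.range (k + 1),
      ∫ τ : ℝ, (-(k ! * wCoef ρ j)) * partRn (1 / a) ρ (k + 1 - j) ((1 / 2 : ℂ) + τ * I) = 0 := by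
    intro j hj
    have hn : 1 ≤ k + 1 - j := by have := Finset.mem_range.1 hj; omega
    have h := integral_partRn_eq_zero (dsl_hyp_of_lt_order hk (Nat.sub_le _ _)) hn hθ hθ1 hρre
    simp only [ofReal_one_half] at h
    rw [integral_const_mul, h, mul_zero]
  have hL0 : ∀ i ∈ Finset.range (k + 1),
      ∫ τ : ℝ, (-(k ! * (-(Lof lam : ℂ)) ^ i / i ! * ((lam : ℂ) ^ ρ / burnolV ρ))) *
        partLn (1 / (a * lam)) ρ (k + 1 - i) ((1 / 2 : ℂ) + τ * I) = 0 := by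
    intro i hi
    have hn : 1 ≤ k + 1 - i := by have := Finset.mem_range.1 hi; omega
    have h := integral_partLn_eq_zero (dsl_hyp_one_sub_of_lt_order hk (Nat.sub_le _ _)) hn hy hρre
    simp only [ofReal_one_half] at h
    rw [integral_const_mul, h, mul_zero]
  calc ∫ τ : ℝ, ((a : ℂ) ^ (-((1 / 2 : ℂ) + τ * I)) *
        (-riemannZeta ((1 / 2 : ℂ) + τ * I) / ((1 / 2 : ℂ) + τ * I))) * burnolKk ρ k lam ((1 / 2 : ℂ) + τ * I)
      = ∫ τ : ℝ, (∑ j ∈ Finset.range (k + 1), (-(k ! * wCoef ρ j)) *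
            partRn (1 / a) ρ (k + 1 - j) ((1 / 2 : ℂ) + τ * I) +
          ∑ i ∈ Finset.range (k + 1), (-(k ! * (-(Lof lam : ℂ)) ^ i / i ! *
            ((lam : ℂ) ^ ρ / burnolV ρ))) * partLn (1 / (a * lam)) ρ (k + 1 - i) ((1 / 2 : ℂ) + τ * I)) := by
        refine integral_congr_ae ?_
        filter_upwards [ae_ne γ] with τ hτ
        exact mellin_fract_mul_burnolKk_eq hk hτ hlam0 hlam1 ha0
    _ = 0 := by
        rw [integral_add (integrable_finsetSum _ hRi) (integrable_finsetSum _ hLi),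
          integral_finsetSum _ hRi, integral_finsetSum _ hLi, Finset.sum_eq_zero hR0,
          Finset.sum_eq_zero hL0, add_zero]

end orthogonality

end BurnolVectors

end Literature.NumberTheory.LFunctions
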